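import Literature.MathematicalPhysics.QuantumFieldTheory.Balaban1983to89.BlockAveragingEMLHaarAC
import Literature.MathematicalPhysics.QuantumFieldTheory.Balaban1983to89.HaarEigenvalueSphereNull
import HarnessLib

/-!
# `FluctuationComparisonRegPrIntLS1aFreshLetterHaar` — A HOLONOMY WITH ONE FRESH STEP IS HAAR-DISTRIBUTED UNDER PRODUCT HAAR MEASURE, and its translated
# `dist1`-spheres are null on `SU(n)` (the group∕product-measure engine of UV3-NODE §77.5 (R2), identity branch)

Cell `ym3-torus` (HUMAN RULING D-0037: rung R3 = continuum SU(2) Yang–Mills on T³ — NOT d = 4, NOT infinite volume, NOT a mass gap, NOT Clay), WIDTH COPY «width 17»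
of ym3-torus-p1, seat `ym3-torus-px17` gen 20; `--kind proof --supports stmt-QuantumFields-20520 --as helper` (count-neutral).  THEOREMS ONLY (no `def`, no `sorry`,
no `instance`, no `notation`, default heartbeats).  FILE 1 of 2 of the INTENT «THE GUARD SPHERES OF ONE (0.4) STEP ARE PRODUCT-HAAR-NULL» (11:12:21Z; first refusal
px13 g24, no «NO»∕«MINE»); FILE 2 `…S1aGuardSphereNull` applies it to the loop words of [Balaban1987RG1] (0.4).

CONTENT ([folklore] measure theory over the tree's `GaugeGroup`∕`HaarData`∕`fieldMeasure = Measure.pi Haar` currency).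
* §1 `extend_const_eq_update`; ★`map_pi_haar_eq_of_fresh`: under product Haar measure on `ι → G` the law of `U ↦ A U · φ (U b) · B U` IS Haar measure whenever `A`, `B`
  are measurable and BLIND to the coordinate `b` and `φ` preserves Haar (resampling ✓`T4TriangularPushforward.measurePreserving_resample` at `β : Unit ↦ b`, the fresh
  factor integrated first by two-sided invariance ✓`BlockAveragingEMLHaarAC.map_haar_mul_mul` and Mathlib `measurePreserving_funUnique`); `…_id` (`φ = id`), `…_inv`
  (`φ = (·)⁻¹`, ✓`HaarData.map_inv` — a letter traversed backwards).
* §2 `holAt_eq_take_mul_step_mul_drop`, `holAt_update_of_forall_ne`; ★★`map_fieldMeasure_holAt_eq_haar` (index form: the step list uses the bond of its `k`-th step once)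
  and ★★`map_fieldMeasure_holAt_split_eq_haar` (split form `γ₁ ++ s₀ :: γ₂`, no step of `γ₁`, `γ₂` on `s₀.bond`): `dU`-law of `U ↦ 𝒰_U(γ)` = Haar.
* §3 on `SU(n)`: ★`fieldMeasure_setOf_dist1_mul_eq_eq_zero` (a Haar-distributed word has null translated spheres `{dist1 (f U · q) = r}`, `r ≠ 0`: right invariance +
  lit ✓`HaarEigenvalueSphereNull.haar_setOf_dist1_eq_eq_zero_specialUnitaryGroup` — pub-ymgap N09's (F2), LANDED), ★★`fieldMeasure_setOf_dist1_holAt_eq_eq_zero`.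

HONEST FRAMING.  Kernel bookkeeping on product Haar measure; nothing of Bałaban's analysis is asserted or proved; it serves the LOCATED road of UV3-NODE §77.5 for S1aᴴ's (c)
residual `hreg` ((R2) identity branch only; (R1), (R2)-EML, (R3) untouched); `hreg`, S1a(ᴴ), the five registered stubs of `Lines/semiclassical_s2beta.lean`, crux 20520 ∕
19936 ∕ 19200 and `YM3TorusSU2` are NOT proved; no registered stub is closed; registry untouched; rung R3 = SU(2) YM₃ on T³ at fixed lattice data — NOT d = 4, NOT infinite
volume, NOT a mass gap, NOT Clay; the Yang–Mills mass gap is NOT proved by any of this.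
References: [Balaban1987RG1] CMP 109 (1987) (0.4) p. 253; [Balaban1985Averaging] CMP 98 (1985) (10) p. 19, (19) p. 21; [BrockerTomDieck1985] IV (2.11) (sphere nullity).
-/

set_option autoImplicit false

noncomputable section

namespace Summit.QuantumFields.YangMills.Theorems.FluctuationComparisonRegPrIntLS1aFreshLetterHaar

open MeasureTheory Set Function
open scoped ENNReal
open Literature.MathematicalPhysics.QuantumFieldTheory.Balaban1983to89
open Literature.MathematicalPhysics.QuantumFieldTheory.Balaban1983to89.BlockAveragingEMLHaarAC (map_haar_mul_mul)

/-! ## §1 A word with a FRESH letter has Haar law under product Haar measure -/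

section Fresh

/-- Resampling ONE coordinate: `extend (fun _ : Unit => b) g U = update U b (g ())`. [folklore] -/
theorem extend_const_eq_update {ι : Type*} [DecidableEq ι] {G : Type*} (b : ι) (g : Unit → G) (U : ι → G) :
    Function.extend (fun _ : Unit => b) g U = Function.update U b (g ()) := by
  funext i
  by_cases h : i = b
  · subst h
    rw [Function.update_self]
    have hβ : Function.Injective (fun _ : Unit => i) := fun _ _ _ => Subsingleton.elim _ _
    exact hβ.extend_apply g U ()
  · rw [Function.update_of_ne h, Function.extend_apply' _ _ _ (fun ⟨u, hu⟩ => h hu.symm)]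

variable {ι : Type*} [Fintype ι] [DecidableEq ι] {G : Type*} [GaugeGroup G] [MeasurableSpace G] [RegularGaugeGroup G] [HaarData G]

/-- ★ **A PRODUCT WITH ONE FRESH HAAR FACTOR IS HAAR-DISTRIBUTED**: under product Haar measure on `ι → G`, the law of
`U ↦ A U · φ (U b) · B U` is Haar measure whenever `A`, `B` are measurable and BLIND to the coordinate `b` and `φ` preserves Haar measure
(`φ = id` or `φ = (·)⁻¹`): resample the coordinate `b` (✓`T4TriangularPushforward.measurePreserving_resample`), integrate it out first
(two-sided invariance ✓`map_haar_mul_mul`), then the rest (a probability). [folklore] -/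
theorem map_pi_haar_eq_of_fresh (b : ι) {A B : (ι → G) → G} {φ : G → G} (hAm : Measurable A) (hBm : Measurable B)
    (hφm : Measurable φ) (hφ : (HaarData.haar : Measure G).map φ = HaarData.haar)
    (hA : ∀ U g, A (Function.update U b g) = A U) (hB : ∀ U g, B (Function.update U b g) = B U) :
    (Measure.pi fun _ : ι => (HaarData.haar : Measure G)).map (fun U => A U * φ (U b) * B U) = HaarData.haar := by
  classical
  haveI : IsProbabilityMeasure (HaarData.haar : Measure G) := HaarData.isProb
  have hβ : Function.Injective (fun _ : Unit => b) := fun _ _ _ => Subsingleton.elim _ _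
  have hres := T4TriangularPushforward.measurePreserving_resample (ι := ι) (κ := Unit) (HaarData.haar : Measure G) hβ
  have hf : Measurable fun U : ι → G => A U * φ (U b) * B U := (hAm.mul (hφm.comp (measurable_pi_apply b))).mul hBm
  have hcomp : (fun U : ι → G => A U * φ (U b) * B U) ∘
      (fun p : (ι → G) × (Unit → G) => Function.extend (fun _ : Unit => b) p.2 p.1) = fun p => A p.1 * φ (p.2 ()) * B p.1 := by
    funext p
    simp only [Function.comp_apply, extend_const_eq_update, hA, hB, Function.update_self]
  rw [← hres.map_eq, Measure.map_map hf hres.measurable, hcomp]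
  have hg : Measurable fun p : (ι → G) × (Unit → G) => A p.1 * φ (p.2 ()) * B p.1 :=
    ((hAm.comp measurable_fst).mul (hφm.comp ((measurable_pi_apply ()).comp measurable_snd))).mul (hBm.comp measurable_fst)
  ext s hs
  rw [Measure.map_apply hg hs, Measure.prod_apply (hg hs)]
  have hinner : ∀ U : ι → G, (Measure.pi fun _ : Unit => (HaarData.haar : Measure G))
      (Prod.mk U ⁻¹' ((fun p : (ι → G) × (Unit → G) => A p.1 * φ (p.2 ()) * B p.1) ⁻¹' s)) = (HaarData.haar : Measure G) s := by
    intro U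
    have hk : Measurable fun h : G => A U * φ h * B U := (measurable_const.mul hφm).mul measurable_const
    have e1 : Prod.mk U ⁻¹' ((fun p : (ι → G) × (Unit → G) => A p.1 * φ (p.2 ()) * B p.1) ⁻¹' s) =
        (⇑(MeasurableEquiv.funUnique Unit G)) ⁻¹' ((fun h : G => A U * φ h * B U) ⁻¹' s) := rfl
    rw [e1, ← Measure.map_apply (MeasurableEquiv.funUnique Unit G).measurable (hk hs),
      (MeasureTheory.measurePreserving_funUnique (HaarData.haar : Measure G) Unit).map_eq, ← Measure.map_apply hk hs]
    have e2 : (fun h : G => A U * φ h * B U) = (fun h : G => A U * h * B U) ∘ φ := rfl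
    have hk2 : Measurable fun h : G => A U * h * B U := (measurable_const.mul measurable_id).mul measurable_const
    rw [e2, ← Measure.map_map hk2 hφm, hφ, map_haar_mul_mul]
  simp_rw [hinner]
  rw [lintegral_const, measure_univ, mul_one]

/-- The identity preserves Haar measure (the `φ = id` case). [folklore] -/
theorem map_pi_haar_eq_of_fresh_id (b : ι) {A B : (ι → G) → G} (hAm : Measurable A) (hBm : Measurable B)
    (hA : ∀ U g, A (Function.update U b g) = A U) (hB : ∀ U g, B (Function.update U b g) = B U) :
    (Measure.pi fun _ : ι => (HaarData.haar : Measure G)).map (fun U => A U * U b * B U) = HaarData.haar :=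
  map_pi_haar_eq_of_fresh b hAm hBm measurable_id Measure.map_id hA hB

/-- The `φ = (·)⁻¹` case (a letter traversed backwards). [folklore] -/
theorem map_pi_haar_eq_of_fresh_inv (b : ι) {A B : (ι → G) → G} (hAm : Measurable A) (hBm : Measurable B)
    (hA : ∀ U g, A (Function.update U b g) = A U) (hB : ∀ U g, B (Function.update U b g) = B U) :
    (Measure.pi fun _ : ι => (HaarData.haar : Measure G)).map (fun U => A U * (U b)⁻¹ * B U) = HaarData.haar :=
  map_pi_haar_eq_of_fresh b hAm hBm measurable_inv HaarData.map_inv hA hB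

end Fresh

/-! ## §2 Holonomies with ONE fresh step are Haar-distributed -/

section Hol

open T4Continuum

variable {P : Params} {j : ℕ} {G : Type*} [GaugeGroup G] [MeasurableSpace G] [RegularGaugeGroup G] [HaarData G]

omit [MeasurableSpace G] [RegularGaugeGroup G] [HaarData G] in
/-- Splitting a holonomy at position `k`: `𝒰(γ) = 𝒰(γ↾k) · U(γ_k)^{±1} · 𝒰(γ⇂(k+1))`. [folklore] -/
theorem holAt_eq_take_mul_step_mul_drop (U : GaugeField P j G) (γ : List (LStep P j)) {k : ℕ} (hk : k < γ.length) :
    holAt U γ = holAt U (γ.take k) * (if (γ[k]).fwd then U (γ[k]).bond else (U (γ[k]).bond)⁻¹) * holAt U (γ.drop (k + 1)) := by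
  conv_lhs => rw [← List.take_append_drop k γ, List.drop_eq_getElem_cons hk]
  rw [holAt_append, holAt_cons, mul_assoc]

omit [MeasurableSpace G] [RegularGaugeGroup G] [HaarData G] in
/-- A holonomy along steps NONE of which uses the bond `b` is blind to `U b`. [folklore] -/
theorem holAt_update_of_forall_ne [DecidableEq (PBond P j)] (U : GaugeField P j G) (γ : List (LStep P j)) (b : PBond P j) (g : G)
    (h : ∀ s ∈ γ, s.bond ≠ b) : holAt (Function.update U b g) γ = holAt U γ :=
  T4ReflectionCone.holAt_congr fun s hs => Function.update_of_ne (h s hs) _ _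

/-- ★★ **A HOLONOMY WITH ONE FRESH STEP IS HAAR-DISTRIBUTED**: if the step list `γ` uses the bond of its `k`-th step exactly once, then under product Haar
measure `dU` the law of `U ↦ 𝒰_U(γ)` is Haar measure. [folklore] -/
theorem map_fieldMeasure_holAt_eq_haar [DecidableEq (PBond P j)] (γ : List (LStep P j)) {k : ℕ} (hk : k < γ.length)
    (huniq : ∀ (k' : ℕ) (hk' : k' < γ.length), (γ[k']).bond = (γ[k]).bond → k' = k) :
    (fieldMeasure P j G).map (fun U : GaugeField P j G => holAt U γ) = HaarData.haar := by
  set b : PBond P j := (γ[k]).bond with hb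
  -- blindness of the two outer factors
  have htake : ∀ s ∈ γ.take k, s.bond ≠ b := by
    intro s hs hsb
    obtain ⟨i, hi, rfl⟩ := List.mem_iff_getElem.1 hs
    rw [List.length_take] at hi
    have hi' : i < γ.length := lt_of_lt_of_le hi (min_le_right _ _)
    have hik : i < k := lt_of_lt_of_le hi (min_le_left _ _)
    rw [List.getElem_take] at hsb
    exact absurd (huniq i hi' hsb) (Nat.ne_of_lt hik)
  have hdrop : ∀ s ∈ γ.drop (k + 1), s.bond ≠ b := by
    intro s hs hsb
    obtain ⟨i, hi, rfl⟩ := List.mem_iff_getElem.1 hs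
    rw [List.length_drop] at hi
    have hi' : k + 1 + i < γ.length := by omega
    rw [List.getElem_drop] at hsb
    have := huniq (k + 1 + i) hi' hsb
    omega
  have hA : ∀ (U : GaugeField P j G) (g : G), holAt (Function.update U b g) (γ.take k) = holAt U (γ.take k) :=
    fun U g => holAt_update_of_forall_ne U _ b g htake
  have hB : ∀ (U : GaugeField P j G) (g : G), holAt (Function.update U b g) (γ.drop (k + 1)) = holAt U (γ.drop (k + 1)) :=
    fun U g => holAt_update_of_forall_ne U _ b g hdrop
  have hfun : (fun U : GaugeField P j G => holAt U γ) =
      fun U => holAt U (γ.take k) * (if (γ[k]).fwd then U b else (U b)⁻¹) * holAt U (γ.drop (k + 1)) :=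
    funext fun U => holAt_eq_take_mul_step_mul_drop U γ hk
  rw [hfun]
  cases hf : (γ[k]).fwd
  · simp only [Bool.false_eq_true, ↓reduceIte]
    exact map_pi_haar_eq_of_fresh_inv (ι := PBond P j) b (measurable_holAt _) (measurable_holAt _) hA hB
  · simp only [↓reduceIte]
    exact map_pi_haar_eq_of_fresh_id (ι := PBond P j) b (measurable_holAt _) (measurable_holAt _) hA hB

/-- ★★ **SPLIT FORM**: `𝒰(γ₁ ++ s₀ :: γ₂)` is Haar-distributed under `dU` as soon as no step of `γ₁`, `γ₂` uses the bond of `s₀`. [folklore] -/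
theorem map_fieldMeasure_holAt_split_eq_haar [DecidableEq (PBond P j)] (γ₁ γ₂ : List (LStep P j)) (s₀ : LStep P j)
    (h₁ : ∀ s ∈ γ₁, s.bond ≠ s₀.bond) (h₂ : ∀ s ∈ γ₂, s.bond ≠ s₀.bond) :
    (fieldMeasure P j G).map (fun U : GaugeField P j G => holAt U (γ₁ ++ s₀ :: γ₂)) = HaarData.haar := by
  have hfun : (fun U : GaugeField P j G => holAt U (γ₁ ++ s₀ :: γ₂)) =
      fun U => holAt U γ₁ * (if s₀.fwd then U s₀.bond else (U s₀.bond)⁻¹) * holAt U γ₂ := by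
    funext U; rw [holAt_append, holAt_cons, mul_assoc]
  have hA : ∀ (U : GaugeField P j G) (g : G), holAt (Function.update U s₀.bond g) γ₁ = holAt U γ₁ :=
    fun U g => holAt_update_of_forall_ne U _ _ g h₁
  have hB : ∀ (U : GaugeField P j G) (g : G), holAt (Function.update U s₀.bond g) γ₂ = holAt U γ₂ :=
    fun U g => holAt_update_of_forall_ne U _ _ g h₂
  rw [hfun]
  cases hf : s₀.fwd
  · simp only [Bool.false_eq_true, ↓reduceIte]
    exact map_pi_haar_eq_of_fresh_inv (ι := PBond P j) s₀.bond (measurable_holAt _) (measurable_holAt _) hA hB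
  · simp only [↓reduceIte]
    exact map_pi_haar_eq_of_fresh_id (ι := PBond P j) s₀.bond (measurable_holAt _) (measurable_holAt _) hA hB

end Hol

/-! ## §3 On `SU(N)`: translated `dist1`-spheres of Haar-distributed words are product-Haar-null -/

section Sphere

open T4Continuum

variable {P : Params} {j : ℕ} {n : Type*} [Fintype n] [DecidableEq n] [Nonempty n]

/-- ★ **TRANSLATED SPHERES OF A HAAR-DISTRIBUTED WORD ARE NULL**: if `U ↦ f U` has Haar law under product Haar measure on `SU(n)`-valued fields, then for
every `q` and every `r ≠ 0` the set `{U | dist1 (f U · q) = r}` is `dU`-null (right invariance + lit ✓`haar_setOf_dist1_eq_eq_zero_specialUnitaryGroup`).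
[cite: Balaban1985Averaging, (19) p.21] -/
theorem fieldMeasure_setOf_dist1_mul_eq_eq_zero {f : GaugeField P j ↥(Matrix.specialUnitaryGroup n ℂ) → ↥(Matrix.specialUnitaryGroup n ℂ)}
    (hf : Measurable f) (hlaw : (fieldMeasure P j ↥(Matrix.specialUnitaryGroup n ℂ)).map f = HaarData.haar)
    (q : ↥(Matrix.specialUnitaryGroup n ℂ)) {r : ℝ} (hr : r ≠ 0) :
    fieldMeasure P j ↥(Matrix.specialUnitaryGroup n ℂ) {U | dist1 (f U * q) = r} = 0 := by
  have hS : MeasurableSet {g : ↥(Matrix.specialUnitaryGroup n ℂ) | dist1 g = r} :=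
    RegularGaugeGroup.measurable_dist1 (measurableSet_singleton r)
  have hmq : Measurable fun g : ↥(Matrix.specialUnitaryGroup n ℂ) => g * q := measurable_mul_const q
  have e : {U : GaugeField P j ↥(Matrix.specialUnitaryGroup n ℂ) | dist1 (f U * q) = r} =
      f ⁻¹' ((fun g => g * q) ⁻¹' {g | dist1 g = r}) := rfl
  rw [e, ← Measure.map_apply hf (hmq hS), hlaw, ← Measure.map_apply hmq hS, HaarData.map_mul_right]
  exact HaarEigenvalueSphereNull.haar_setOf_dist1_eq_eq_zero_specialUnitaryGroup hr

/-- ★★ **THE SPHERE `{dist1 𝒰(γ) = r}` OF A HOLONOMY WITH ONE FRESH STEP IS NULL** (`r ≠ 0`; also translated by any `q`). [cite: Balaban1985Averaging, (19) p.21] -/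
theorem fieldMeasure_setOf_dist1_holAt_eq_eq_zero (γ : List (LStep P j)) {k : ℕ} (hk : k < γ.length)
    (huniq : ∀ (k' : ℕ) (hk' : k' < γ.length), (γ[k']).bond = (γ[k]).bond → k' = k)
    (q : ↥(Matrix.specialUnitaryGroup n ℂ)) {r : ℝ} (hr : r ≠ 0) :
    fieldMeasure P j ↥(Matrix.specialUnitaryGroup n ℂ) {U | dist1 (holAt U γ * q) = r} = 0 := by
  classical
  exact fieldMeasure_setOf_dist1_mul_eq_eq_zero (measurable_holAt γ) (map_fieldMeasure_holAt_eq_haar γ hk huniq) q hr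

end Sphere

end Summit.QuantumFields.YangMills.Theorems.FluctuationComparisonRegPrIntLS1aFreshLetterHaar

end
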